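import Literature.IUT.LogVolume.PrimewisePackets
import Mathlib.Order.ConditionallyCompleteLattice.Basic
import HarnessLib

/-!
# The valuation-line packet and the completion of a prime-indexed family of packets by it
# (Dupuy–Hilado Def. 3.6.3 "`𝕃 = Π_p 𝕃_p`"; bookkeeping companion of `PrimewisePackets`)

Dupuy–Hilado, arXiv:2004.13228 (pre-split text) Def. 3.6.3, read on the page (render chunk 12): "`𝕃 = Π_p 𝕃_p`,
`ln ν̄_𝕃(B) = Σ_p ln ν̄_{𝕃_p}(B_p)`". `PrimewisePackets.lean` assembles an `IndPacketModel F` from packets given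
at PRIMES, completing the family at the composite indices `p` (where the interface's index set
`placesOver F p` is junk but non-empty) by the one-point packet. That completion is too small for the
summit-side `DHData` (`Summits/ABC/IUTFork/LDHCor312.lean`), whose idele fields ask, at EVERY index `p`, for
local scalars of prescribed valuation `ord_v(t_{Θ,j,v}) = P_{Θ,j}(v)` — possibly `≠ 0` at a junk index whose
places meet the bad set `S`, while the one-point packet has `ord ≡ 0`.

This file supplies the completion that makes those conditions satisfiable at composite indices while
changing nothing at primes:

* `PrimePacket.line F p` — the VALUATION LINE at the index `p`, a TOY INSTANCE of the interface (the same toy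
  as the summit-side vacuity witness `valLine`, here per index and in `Literature`; not an object of the paper): every summand is `ℝ` ("minus the valuation"), the
  admissible sets are the rays `[r,∞)` with `log μ̄([r,∞)) = −r`, `O = I = [0,∞)`, `Λ_v = ℝ` with `ord_v = id`,
  the peel action of `a` is translation by `a·ln|κ(v)|/n_v` (so (3.7)/(3.4) hold by `rfl`-arithmetic), (Ind1)
  transports and (Ind2) are identities, the hull is the identity;
* `IndPacketModel.ofPrimesLine P` — real packets `P p hp` at primes, the valuation line elsewhere — with the
  transfer lemmas `primePart_ofPrimesLine` (at a prime the `p`-part IS `P p hp`), `ofPrimesLine_elim`,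
  `primePart_ofPrimesLine_of_not_prime`.
Log-measures are only ever summed over finite sets of PRIMES, so the completion is never read by `ln ν̄_𝕃`.
[cite: DupuyHilado2025, Def. 3.6.3, §3.4, §3.7] Pure bookkeeping; nothing disputed.
-/

noncomputable section

namespace Literature.IUT.LogVolume

open NumberField IsDedekindDomain
open scoped Pointwise

universe u

variable (F : Type u) [Field F] [NumberField F]

/-! ## Rays on the real line -/

namespace Line

/-- The toy log-measure `log μ̄([r, ∞)) := −r` (as `−inf A`). [folklore] -/
def rayLog (A : Set ℝ) : ℝ := -sInf A

/-- `log μ̄([r,∞)) = −r`. [folklore] -/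
private theorem rayLog_Ici (r : ℝ) : rayLog (Set.Ici r) = -r := by rw [rayLog, csInf_Ici]

/-- `log μ̄` is monotone on rays. [folklore] -/
private theorem rayLog_mono {A B : Set ℝ} (hA : ∃ r : ℝ, A = Set.Ici r) (hB : ∃ r : ℝ, B = Set.Ici r)
    (h : A ⊆ B) : rayLog A ≤ rayLog B := by
  obtain ⟨a, rfl⟩ := hA
  obtain ⟨b, rfl⟩ := hB
  rw [rayLog_Ici, rayLog_Ici, neg_le_neg_iff]
  exact Set.Ici_subset_Ici.mp h

variable {F} in
/-- The scaling constant `ln|κ(v)|/n_v` of a place (the (3.4) factor). [cite: DupuyHilado2025, §3.4] -/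
def c {p : ℕ} (v : placesOver F p) : ℝ := logNorm F v.1 / localDegree F v.1

/-- The trivial action of the one-element group on `ℝ` (the (Ind2) slot of the line). [folklore] -/
@[reducible] def trivAction : MulAction PUnit.{1} ℝ where
  smul _ x := x
  one_smul _ := rfl
  mul_smul _ _ _ := rfl

end Line

open Line in
/-- **The valuation line at the index `p`** — a TOY INSTANCE of the interface `PrimePacket` (the author's
bookkeeping device, NOT an object of Dupuy–Hilado's paper; the cite below locates the interface axioms it
instantiates, (3.4)/(3.7) and the (Ind1)/(Ind2)/hull slots): summands `ℝ`, admissible sets the rays `[r,∞)`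
with `log μ̄([r,∞)) = −r`, `O = I = [0,∞)`, `Λ_v = ℝ` with `ord_v = id` (so EVERY real valuation is realised),
peel action of `a` = translation by `a·ln|κ(v)|/n_v`, identity transports/actions/hull. Every axiom holds by a
one-line computation on rays. (`reducible`, like the summit-side `valLine`, so that instance search sees the
summands as `ℝ`.) [cite: DupuyHilado2025, §3.4, §3.7, §4.7–4.12] -/
@[reducible] def PrimePacket.line (p : ℕ) : PrimePacket F p where
  X _ _ := ℝ
  adm A := ∃ r : ℝ, A = Set.Ici r
  logμ A := rayLog A
  logμ_mono hA hB hAB := rayLog_mono hA hB hAB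
  O _ _ := Set.Ici 0
  O_adm _ _ := ⟨0, rfl⟩
  logμ_O _ _ := by simp [rayLog_Ici]
  Λ _ := ℝ
  ordv a := a
  peel {j e} a := fun x => x + a * c (e (Fin.last j))
  peel_adm {j e} a U hU := by
    obtain ⟨r, rfl⟩ := hU
    exact ⟨r + a * c (e (Fin.last j)), Set.image_add_const_Ici _ _⟩
  logμ_peel {j e} a U hU := by
    obtain ⟨r, rfl⟩ := hU
    rw [Set.image_add_const_Ici, rayLog_Ici, rayLog_Ici, c]
    ring
  shell _ _ := Set.Ici 0
  shell_adm _ _ := ⟨0, rfl⟩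
  perm _ _ := Equiv.refl ℝ
  perm_one _ _ := rfl
  perm_adm _ _ U hU := by simpa using hU
  logμ_perm _ _ U _ := by simp
  perm_shell _ _ := by simp
  G₂ _ _ := PUnit
  group₂ _ _ := inferInstance
  action₂ _ _ := trivAction
  smul_adm g U hU := by
    show ∃ r : ℝ, ((fun x : ℝ => x) '' U) = Set.Ici r
    rwa [Set.image_id']
  logμ_smul g U hU := by
    show rayLog ((fun x : ℝ => x) '' U) = rayLog U
    rw [Set.image_id']
  smul_shell g := by
    show ((fun x : ℝ => x) '' Set.Ici (0 : ℝ)) = Set.Ici 0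
    rw [Set.image_id']
  hullLoc _ _ := ClosureOperator.id (Set ℝ)

variable {F}

/-! ## Completion of a prime-indexed family by the valuation line -/

open Classical in
/-- **The model built from packets given at primes**, completed by the VALUATION LINE at the non-prime indices
(see the module docstring for why the line and not the point). [cite: DupuyHilado2025, Def. 3.6.3] -/
def IndPacketModel.ofPrimesLine (P : ∀ p : ℕ, p.Prime → PrimePacket F p) : IndPacketModel F :=
  IndPacketModel.ofPrimewise fun p => if hp : p.Prime then P p hp else PrimePacket.line F p

/-- **At a prime `p`, the `p`-part of `ofPrimesLine P` IS `P p`.** [cite: DupuyHilado2025, Def. 3.6.3] -/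
theorem IndPacketModel.primePart_ofPrimesLine (P : ∀ p : ℕ, p.Prime → PrimePacket F p) {p : ℕ}
    (hp : p.Prime) : (IndPacketModel.ofPrimesLine P).primePart p = P p hp := by
  classical
  rw [IndPacketModel.ofPrimesLine, IndPacketModel.primePart_ofPrimewise, dif_pos hp]

/-- At a non-prime index the `p`-part of `ofPrimesLine P` is the valuation line.
[cite: DupuyHilado2025, Def. 3.6.3] -/
theorem IndPacketModel.primePart_ofPrimesLine_of_not_prime (P : ∀ p : ℕ, p.Prime → PrimePacket F p)
    {p : ℕ} (hp : ¬ p.Prime) : (IndPacketModel.ofPrimesLine P).primePart p = PrimePacket.line F p := by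
  classical
  rw [IndPacketModel.ofPrimesLine, IndPacketModel.primePart_ofPrimewise, dif_neg hp]

/-- **Transfer**: a property of prime packets holding for `P p hp` holds for the `p`-part of `ofPrimesLine P`.
[cite: DupuyHilado2025, Def. 3.6.3] -/
theorem IndPacketModel.ofPrimesLine_elim (P : ∀ p : ℕ, p.Prime → PrimePacket F p) {p : ℕ} (hp : p.Prime)
    (C : PrimePacket F p → Prop) (h : C (P p hp)) : C ((IndPacketModel.ofPrimesLine P).primePart p) := by
  rw [IndPacketModel.primePart_ofPrimesLine P hp]
  exact h

/-- Transfer at a non-prime index: a property of the valuation line holds for the `p`-part.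
[cite: DupuyHilado2025, Def. 3.6.3] -/
theorem IndPacketModel.ofPrimesLine_elim_of_not_prime (P : ∀ p : ℕ, p.Prime → PrimePacket F p) {p : ℕ}
    (hp : ¬ p.Prime) (C : PrimePacket F p → Prop) (h : C (PrimePacket.line F p)) :
    C ((IndPacketModel.ofPrimesLine P).primePart p) := by
  rw [IndPacketModel.primePart_ofPrimesLine_of_not_prime P hp]
  exact h

/-! ## Data over a model's `p`-parts: transport along equalities of prime packets -/

/-- **Transport of `p`-local structures**: any type family over prime packets moves along an equality of
packets (used to move per-prime data given over `P p hp` onto the `p`-part of `ofPrimesLine P`, whose TYPE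
mentions the model). [cite: DupuyHilado2025, Def. 3.6.3] -/
def PrimePacket.transport {p : ℕ} (D : PrimePacket F p → Sort*) {Q Q' : PrimePacket F p} (h : Q = Q')
    (d : D Q') : D Q := h ▸ d

/-- Transport along `rfl` is the identity. [cite: DupuyHilado2025, Def. 3.6.3] -/
@[simp] theorem PrimePacket.transport_rfl {p : ℕ} (D : PrimePacket F p → Sort*) {Q : PrimePacket F p}
    (d : D Q) : PrimePacket.transport D rfl d = d := rfl

end Literature.IUT.LogVolume

end
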